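import Summits.QuantumFields.BalabanUV.T4Continuum.Support.NE9RemainderSpeciesCoupling
import Summits.QuantumFields.BalabanUV.T4Continuum.Support.NE9Lemma1RemainderSpeciesAdditive

/-!
# NE9RemainderSpeciesWitness — NON-VACUITY of the displayed species' CHANNEL-SIDE binder set: a toy datum with NONEMPTY index
# families and COUPLING-DEPENDENT family and directions meeting `RemData.Admissible`, the level counts, leaf A3's direction
# binders (d1)–(d3), crew row (w16)'s GLOBAL direction pair, analyticity and the (1.18)-type size — on which A3-REM and (w16) FIRE
# (cell `pub-balaban`, T4-DAG §2 node U3 ∕ §6 NE9; NE9 formalisation swarm, unit `b2b-balaban-t4-ne9-formalise-leaf-09` gen 5,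
# own-initiative micro-item «REM-WITNESS», CLAIMS.log l.9595)

HONEST FRAMING (T4-DAG PAGE 1).  Rung (B)+1 of the FINITE-VOLUME T⁴ programme — NOT infinite volume, NOT a mass gap, NOT the
Clay problem.  NE9 (`T4OutputRate.NE9` ∧ `FadingMemory`) is a cell NEW ESTIMATE, NOT PRINTED, NOT discharged here; spine 0/9;
0/18 skeleton leaves instantiated on Bałaban's objects (O-NE9-1) — a TOY instantiates NO leaf.  HONEST DEPENDENCY (cell line,
verbatim): continuum YM on T⁴ ⇐ BetaPertH ∧ nine spine estimates (0/9 proved); BetaPertH ⇐ (D1) ∧ (D4) ∧ CAP+tail; G-an2-4 gates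
asym, D1 and NE2/3/4.  `FlowStep.BetaPertH`, (B), (B^μ) do not occur.  Nothing of [I] = [Balaban1987RG1] ∕ [II] =
[Balaban1988RG2Cluster] is quoted as a hypothesis; the toy below is a CARICATURE (labelled so), not Bałaban's (1.23).

WHY.  The species END faces of row NE9 (owner's part 3 p213009, MP-REM p213217, A3-REM-END p213409, E5′-REM p213078 …) display on
the channel side a SET of binders about one datum `D : RemData …`: `D.Admissible ℓ c_dir d₀` (ten fields), `LevelCountsG D.toC.frame …`
(five fields), leaf A3's direction binders (d1) contour-continuity ∕ (d2) relative coupling-Lipschitz modulus ∕ (d3) `c_dir·ℓ < 1∕2`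
(A3-REM p213083), crew row (w16)'s GLOBAL direction pair `hdirC` ∕ `hdirR` (p213082), and the family's analyticity + (1.18)-type size.
The only datum exhibited so far is the EMPTY one (leaf-01-g5's probe, CLAIMS l.9102: all binders vacuous), and the two direction
conventions are met together only by directions CLAMPED off the contours (XREAD C-ne9leaf09g5-2 INFO 1).  THIS FILE exhibits a
NON-trivial datum meeting ALL of them at once, with the producers applied BY NAME — so the binder set is jointly satisfiable with
nonempty index families and genuine coupling dependence, and no hidden contradiction sits in the typing.

THE TOY (labelled toy).  Carriers `T4HistoryLipschitzRecursion.toyCarriers` (domain = creation step, d ≡ 0) doubled; configuration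
space ℂ.  Datum `wRem γ`: one box, one domain, one cube; at step k the two sources (k, re), (k, im) (none below the diagonal);
`d_k(Y) ≡ 0`, `κ₁ = 1`, `r_k = 1∕8`, `R_X ≡ 1`, `dirB ≡ γ∕8`; direction `wDir γ k s … t … := clamp_{1∕8}(t) · clamp_γ(s k)` — LINEAR in
the contour variable ON the contour and in the k-th coupling ON the window, clamped elsewhere (caricature of (tζ̃_□ + t_□ζ_□)𝐇_k ∝ g_k).
Family `wE γ g U (j, re∕im) := clamp_γ(g j) · Re∕Im(U⁶)` on ‖U‖ < 1, 0 outside — bounded, coupling-dependent, with `lift = clamp_γ(g j)·U⁶`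
on the ball (a genuine sixth-order term, so its fifth-order remainder is not zero).

WHAT IS PROVED (kernel; toy data are `def`s, statements `[folklore]`; 0 sorry).
§1 clamps: `tClamp`, `gClamp` + continuity ∕ bounds ∕ 1-Lipschitz ∕ identity on the contour resp. window.
§2 `srcPair`, the datum `wRem`, the family `wE`; **`admissible_wRem`** (`(wRem γ).Admissible (fun _ _ => 1) (1∕4) 0`, 0 ≤ γ ≤ 1),
   **`levelCountsG_wRem`** (`LevelCountsG (wRem γ).toC.frame κ 1 2 1 (fun _ _ => 1) (agePow ω)`, 0 ≤ ω), `lift_wE`, **`wE_mem_analyticClass`**,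
   `admissibleTerms_wE`, **`termSize_wE`**, the direction binders in BOTH conventions: `dir_contourContinuous_wRem` (d1),
   `dir_couplingLipschitz_wRem` (d2, `cA = 1∕2`), `dir_continuous_wRem` ((w16) `hdirC`), `dir_lt_radius_wRem` ((w16) `hdirR`).
§3 THE PRODUCERS FIRE: **`cpieceResponse_witness`** (leaf-03-g4's `cpieceResponse_rem` APPLIED to the toy — an actual per-piece
   coupling-response inequality), **`sBinders_witness`** ((w16)'s `sBinders_rem` APPLIED — S3 ∧ S4 ∧ S5 for the toy on its analytic class).
DISGUISE TEST: a toy datum; elementary real∕complex analysis; producers applied by name — not NE9, not an instantiation.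
-/

noncomputable section

namespace Summit.QuantumFields.BalabanUV.T4Continuum.NE9RemainderSpeciesWitness

open scoped BigOperators
open Metric Set
open Literature.MathematicalPhysics.QuantumFieldTheory.Balaban1983to89
open Literature.MathematicalPhysics.QuantumFieldTheory.Balaban1983to89.T4OutputRate
open Literature.MathematicalPhysics.QuantumFieldTheory.Balaban1983to89.T4HistoryLipschitzRecursion
open Literature.MathematicalPhysics.QuantumFieldTheory.Balaban1983to89.T4HistoryLipschitzSegment
open Summit.QuantumFields.BalabanUV.T4Continuum.NE9Lemma1Counting
open Summit.QuantumFields.BalabanUV.T4Continuum.NE9Lemma1Gain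
open Summit.QuantumFields.BalabanUV.T4Continuum.NE9Lemma1PieceClass
open Summit.QuantumFields.BalabanUV.T4Continuum.NE9Lemma1RemainderSpecies
open Summit.QuantumFields.BalabanUV.T4Continuum.NE9ComplexEncoding (doubleCarriers)
open Summit.QuantumFields.BalabanUV.T4Continuum.NE9RemainderSpeciesCoupling (cpieceResponse_rem)
open Summit.QuantumFields.BalabanUV.T4Continuum.NE9Lemma1RemainderSpeciesAdditive (sBinders_rem)

/-! ## §1 The two clamps -/

/-- The contour-variable clamp: `t ↦ (r ∕ max ‖t‖ r)·t` — the identity on the closed disc of radius `r`, radial retraction outside.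
[folklore] -/
def tClamp (r : ℝ) (t : ℂ) : ℂ := ((r / max ‖t‖ r : ℝ) : ℂ) * t

/-- The clamp is continuous (r > 0). [folklore] -/
theorem continuous_tClamp {r : ℝ} (hr : 0 < r) : Continuous (tClamp r) := by
  have h1 : Continuous fun t : ℂ => max ‖t‖ r := continuous_norm.max continuous_const
  have h2 : ∀ t : ℂ, max ‖t‖ r ≠ 0 := fun t => (lt_of_lt_of_le hr (le_max_right _ _)).ne'
  have h3 : Continuous fun t : ℂ => r / max ‖t‖ r := continuous_const.div h1 h2
  exact (Complex.continuous_ofReal.comp h3).mul continuous_id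

/-- The clamp has norm at most `r`. [folklore] -/
theorem norm_tClamp_le {r : ℝ} (hr : 0 < r) (t : ℂ) : ‖tClamp r t‖ ≤ r := by
  unfold tClamp
  have hm : 0 < max ‖t‖ r := lt_of_lt_of_le hr (le_max_right _ _)
  rw [norm_mul, Complex.norm_real, Real.norm_eq_abs, abs_of_pos (div_pos hr hm), div_mul_eq_mul_div, div_le_iff₀ hm]
  exact mul_le_mul_of_nonneg_left (le_max_left _ _) hr.le

/-- On the contour `|t| = r` the clamp is the identity. [folklore] -/
theorem tClamp_of_mem_sphere {r : ℝ} (hr : 0 < r) {t : ℂ} (ht : t ∈ sphere (0:ℂ) r) : tClamp r t = t := by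
  have hn : ‖t‖ = r := by simpa using ht
  unfold tClamp
  rw [hn, max_self, div_self hr.ne', Complex.ofReal_one, one_mul]

/-- The coupling clamp onto `[−γ, γ]`. [folklore] -/
def gClamp (γ u : ℝ) : ℝ := max (-γ) (min u γ)

/-- `|clamp_γ u| ≤ γ` (γ ≥ 0). [folklore] -/
theorem abs_gClamp_le {γ : ℝ} (hγ : 0 ≤ γ) (u : ℝ) : |gClamp γ u| ≤ γ := by
  unfold gClamp
  rw [abs_le]
  exact ⟨le_max_left _ _, max_le (by linarith) (min_le_right _ _)⟩

/-- The coupling clamp is 1-Lipschitz. [folklore] -/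
theorem abs_gClamp_sub_le (γ u u' : ℝ) : |gClamp γ u - gClamp γ u'| ≤ |u - u'| := by
  unfold gClamp
  calc |max (-γ) (min u γ) - max (-γ) (min u' γ)| ≤ max |(-γ) - (-γ)| |min u γ - min u' γ| := abs_max_sub_max_le_max _ _ _ _
    _ ≤ max |(-γ) - (-γ)| (max |u - u'| |γ - γ|) := max_le_max le_rfl (abs_min_sub_min_le_max _ _ _ _)
    _ = |u - u'| := by simp [abs_nonneg]

/-- On the window `0 < u ≤ γ` the coupling clamp is the identity. [folklore] -/
theorem gClamp_of_window {γ u : ℝ} (h0 : 0 < u) (hu : u ≤ γ) : gClamp γ u = u := by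
  unfold gClamp
  rw [min_eq_left hu, max_eq_right (by linarith)]

/-! ## §2 The toy datum and family; the binders -/

/-- The two sources of creation step `k`: `(k, re)` and `(k, im)` — the image of `Bool` (no `Finset` literal on the `def`-wrapped
domain type). [folklore] -/
def srcPair (k : ℕ) : Finset (doubleCarriers toyCarriers).Dom :=
  (Finset.univ : Finset Bool).map ⟨fun b => (k, b), fun _ _ h => (Prod.mk.inj h).2⟩

/-- Members of the source pair have creation step `k`. [folklore] -/
theorem fst_eq_of_mem_srcPair {k : ℕ} {x : (doubleCarriers toyCarriers).Dom} (hx : x ∈ srcPair k) : x.1 = k := by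
  obtain ⟨b, -, rfl⟩ := Finset.mem_map.1 hx
  rfl

/-- The decay-free sum over the source pair is `2`. [folklore] -/
theorem sum_srcPair_const (k : ℕ) (c : ℝ) : ∑ _x ∈ srcPair k, c = 2 * c := by
  rw [Finset.sum_const, nsmul_eq_mul, srcPair, Finset.card_map, Finset.card_univ, Fintype.card_bool]
  norm_num

/-- The toy direction (labelled toy): `clamp_{1∕8}(t) · clamp_γ(s k)` — linear in the contour variable on the contour `|t| = 1∕8` and
in the k-th coupling on the window, clamped elsewhere. [folklore] -/
def wDir (γ : ℝ) : ℕ → (ℕ → ℝ) → Unit → Unit → Unit → (doubleCarriers toyCarriers).Dom → ℂ → (Unit → ℝ) → (Unit → ℂ) → ℂ :=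
  fun k s _ _ _ _ t _ _ => tClamp (1 / 8) t * (gClamp γ (s k) : ℂ)

/-- THE TOY DATUM (labelled toy): one box, one domain, one cube, the two sources of the current step, `d_k(Y) ≡ 0`, `κ₁ = 1`,
`r_k = 1∕8`, `R ≡ 1`, `dirB ≡ γ∕8`, directions `wDir γ`. [folklore] -/
def wRem (γ : ℝ) : RemData toyCarriers ℂ Unit Unit Unit Unit Unit where
  S0 := fun _ _ => {()}
  SY := fun _ _ _ => {()}
  src := fun k _ _ j => if j = k then srcPair k else ∅
  Sq := fun k _ _ j => if j = k then {()} else ∅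
  SX := fun k _ _ j _ => if j = k then srcPair k else ∅
  dY := fun _ _ => 0
  κ₁ := 1
  r := fun _ => 1 / 8
  cubes := fun _ _ _ _ => [()]
  dir := wDir γ
  R := fun _ => 1
  dirB := fun _ _ _ _ _ _ => γ / 8

/-- THE TOY FAMILY (labelled toy): `wE γ g U (j, re∕im) := clamp_γ(g j) · Re∕Im(U⁶)` on the unit ball, `0` outside. [folklore] -/
def wE (γ : ℝ) : Functional (doubleCarriers toyCarriers) ℂ :=
  fun g U X => if ‖U‖ < 1 then gClamp γ (g X.1) * reIm X.2 (U ^ 6) else 0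

/-- **`RemData.Admissible` FOR THE TOY** with `ℓ ≡ 1`, `c_dir = 1∕4`, `d₀ = 0` (all ten fields), for `0 ≤ γ ≤ 1`. [folklore] -/
theorem admissible_wRem {γ : ℝ} (hγ0 : 0 ≤ γ) (hγ1 : γ ≤ 1) : (wRem γ).Admissible (fun _ _ => 1) (1 / 4) 0 where
  κ₁_ge := le_rfl
  r_pos := fun _ => by show (0:ℝ) < 1 / 8; norm_num
  R_pos := fun _ => by show (0:ℝ) < 1; norm_num
  dir_le := by
    intro k s y a b x t _ s' σ' _
    show ‖tClamp (1 / 8) t * (gClamp γ (s k) : ℂ)‖ ≤ γ / 8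
    rw [norm_mul, Complex.norm_real, Real.norm_eq_abs]
    have h1 := norm_tClamp_le (by norm_num : (0:ℝ) < 1 / 8) t
    have h2 := abs_gClamp_le hγ0 (s k)
    calc ‖tClamp (1 / 8) t‖ * |gClamp γ (s k)| ≤ (1 / 8) * γ :=
          mul_le_mul h1 h2 (abs_nonneg _) (by norm_num)
      _ = γ / 8 := by ring
  dirB_lt := fun _ _ _ _ _ _ => by show γ / 8 < 1; linarith
  dirB_le := fun _ _ _ _ _ _ _ _ _ _ => by show γ / 8 ≤ 1 / 4 * 1 * 1; linarith
  srcScale := by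
    intro k y a j x hx
    change x ∈ (if j = k then srcPair k else ∅) at hx
    split_ifs at hx with h
    · change x.1 = j
      rw [fst_eq_of_mem_srcPair hx, h]
    · simp at hx
  G1 := fun _ _ _ _ _ _ => by show (0:ℝ) ≤ 0 + 4 * (([()] : List Unit).length : ℝ); simp
  d0_nonneg := le_rfl
  cdir_nonneg := by norm_num

/-- **THE LEVEL COUNTS FOR THE TOY** (`O1 = 2`, `c_Q = 1`, gain `1`, profile `agePow ω`): the current step carries one counting cube
with the two sources; nothing below the diagonal. [folklore] -/
theorem levelCountsG_wRem (γ κ : ℝ) {ω : ℝ} (hω : 0 ≤ ω) :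
    LevelCountsG (wRem γ).toC.frame κ (wRem γ).κ₁ 2 1 (fun _ _ => (1:ℝ) ^ 5) (agePow ω) where
  cover := by
    intro k y a j x hx
    change x ∈ (if j = k then srcPair k else ∅) at hx
    refine ⟨(), ?_, ?_⟩
    · change () ∈ (if j = k then ({()} : Finset Unit) else ∅)
      split_ifs with h
      · simp
      · simp [h] at hx
    · change x ∈ (if j = k then srcPair k else ∅)
      exact hx
  sumX := by
    intro k y a j q _
    change ∑ x ∈ (if j = k then srcPair k else ∅), Real.exp (-(κ * (0:ℝ))) ≤ 2
    split_ifs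
    · rw [sum_srcPair_const]
      norm_num
    · simp
  countQ := by
    intro k y a j
    change (((if j = k then ({()} : Finset Unit) else ∅)).card : ℝ) * (1:ℝ) ^ 5 ≤ 1 * agePow ω k j
    split_ifs with h
    · subst h; simp [agePow]
    · simpa using agePow_nonneg hω k j
  sumY := by
    intro k y a _
    change ∑ b ∈ ({()} : Finset Unit), Real.exp (-(1 / 2) * ((1:ℝ) - 1) * (([()] : List Unit).length : ℝ)) ≤ Real.exp 1
    simp
  count0 := by
    intro k y
    change ((({()} : Finset Unit)).card : ℝ) ≤ Real.exp ((1 / 16) * ((1:ℝ) - 2) * 0)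
    simp

/-- The complex read-back of the toy family: `lift (wE γ g) j = clamp_γ(g j)·U⁶` on the unit ball, `0` outside. [folklore] -/
theorem lift_wE (γ : ℝ) (g : ℕ → ℝ) (j : ℕ) :
    lift (wE γ g) j = fun U => if ‖U‖ < 1 then (gClamp γ (g j) : ℂ) * U ^ 6 else 0 := by
  funext U
  by_cases h : ‖U‖ < 1
  · rw [if_pos h]; apply Complex.ext <;> simp [lift, wE, reIm, h]
  · rw [if_neg h]; apply Complex.ext <;> simp [lift, wE, h]

/-- **THE TOY FAMILY IS IN THE ANALYTIC CLASS** of the datum (radius 1): its lift agrees with the polynomial `clamp_γ(g j)·U⁶` on the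
open unit ball. [folklore] -/
theorem wE_mem_analyticClass (γ : ℝ) (g : ℕ → ℝ) : wE γ g ∈ analyticClass (wRem γ).R := by
  intro j
  change DifferentiableOn ℂ (lift (wE γ g) j) (ball 0 1)
  rw [lift_wE]
  have hpoly : DifferentiableOn ℂ (fun U : ℂ => (gClamp γ (g j) : ℂ) * U ^ 6) (ball 0 1) :=
    (differentiable_const _).differentiableOn.mul (differentiable_pow 6).differentiableOn
  exact hpoly.congr fun U hU => by rw [if_pos (mem_ball_zero_iff.1 hU)]

/-- S1-type membership for the toy: every history's family is analytic and the class is closed under differences. [folklore] -/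
theorem admissibleTerms_wE (γ : ℝ) (W : Set (ℕ → ℝ)) : AdmissibleTerms (wE γ) W (analyticClass (wRem γ).R) :=
  ⟨fun g _ => wE_mem_analyticClass γ g, fun _ h₁ _ h₂ => sub_mem_analyticClass h₁ h₂⟩

/-- **THE (1.18)-TYPE SIZE OF THE TOY FAMILY**: `|wE γ g U X| ≤ e^{−κ·0}·γ` — `TermSize (wE γ) W κ (fun _ => γ)` (γ ≥ 0). [folklore] -/
theorem termSize_wE {γ : ℝ} (hγ0 : 0 ≤ γ) (W : Set (ℕ → ℝ)) (κ : ℝ) : TermSize (wE γ) W κ (fun _ => γ) := by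
  intro g _ U X
  have hd : (doubleCarriers toyCarriers).d X = 0 := rfl
  rw [hd, mul_zero, neg_zero, Real.exp_zero, one_mul]
  unfold wE
  split_ifs with hU
  · rw [abs_mul]
    have h6 : |reIm X.2 (U ^ 6)| ≤ 1 := by
      refine (abs_reIm_le _ _).trans ?_
      rw [norm_pow]
      exact pow_le_one₀ (norm_nonneg _) hU.le
    calc |gClamp γ (g X.1)| * |reIm X.2 (U ^ 6)| ≤ γ * 1 := mul_le_mul (abs_gClamp_le hγ0 _) h6 (abs_nonneg _) hγ0
      _ = γ := mul_one γ
  · simpa using hγ0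

/-- (d1) FOR THE TOY: the directions are continuous on the contours (indeed everywhere). [folklore] -/
theorem dir_contourContinuous_wRem (γ : ℝ) :
    ∀ (k : ℕ) (s : ℕ → ℝ) (y a b : Unit) (x : (doubleCarriers toyCarriers).Dom),
      ContinuousOn (fun p : ℂ × ((Unit → ℝ) × (Unit → ℂ)) => (wRem γ).dir k s y a b x p.1 p.2.1 p.2.2)
        (sphere (0:ℂ) ((wRem γ).r k) ×ˢ {q | OnContour (wRem γ).κ₁ ((wRem γ).cubes k y a b) q.1 q.2}) := by
  intro k s y a b x
  refine Continuous.continuousOn ?_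
  show Continuous fun p : ℂ × ((Unit → ℝ) × (Unit → ℂ)) => tClamp (1 / 8) p.1 * (gClamp γ (s k) : ℂ)
  exact ((continuous_tClamp (by norm_num)).comp continuous_fst).mul continuous_const

/-- (w16)'s `hdirC` FOR THE TOY: joint continuity everywhere. [folklore] -/
theorem dir_continuous_wRem (γ : ℝ) :
    ∀ (k : ℕ) (s : ℕ → ℝ) (y a b : Unit) (x : (doubleCarriers toyCarriers).Dom),
      Continuous fun p : ℂ × (Unit → ℝ) × (Unit → ℂ) => (wRem γ).dir k s y a b x p.1 p.2.1 p.2.2 := by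
  intro k s y a b x
  show Continuous fun p : ℂ × ((Unit → ℝ) × (Unit → ℂ)) => tClamp (1 / 8) p.1 * (gClamp γ (s k) : ℂ)
  exact ((continuous_tClamp (by norm_num)).comp continuous_fst).mul continuous_const

/-- (w16)'s `hdirR` FOR THE TOY: the directions stay strictly inside the analyticity radius EVERYWHERE (the clamp). [folklore] -/
theorem dir_lt_radius_wRem {γ : ℝ} (hγ0 : 0 ≤ γ) (hγ1 : γ ≤ 1) :
    ∀ (k : ℕ) (s : ℕ → ℝ) (y a b : Unit) (x : (doubleCarriers toyCarriers).Dom) (t : ℂ) (s' : Unit → ℝ) (σ' : Unit → ℂ),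
      ‖(wRem γ).dir k s y a b x t s' σ'‖ < (wRem γ).R x.1 := by
  intro k s y a b x t s' σ'
  show ‖tClamp (1 / 8) t * (gClamp γ (s k) : ℂ)‖ < 1
  rw [norm_mul, Complex.norm_real, Real.norm_eq_abs]
  calc ‖tClamp (1 / 8) t‖ * |gClamp γ (s k)| ≤ (1 / 8) * γ :=
        mul_le_mul (norm_tClamp_le (by norm_num) t) (abs_gClamp_le hγ0 _) (abs_nonneg _) (by norm_num)
    _ < 1 := by linarith

/-- (d2) FOR THE TOY: on the contour `|t| = 1∕8` the directions are Lipschitz in the k-th coupling with the RELATIVE modulus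
`(1∕2)·(c_dir·ℓ·R)·|g k − g′ k| = (1∕8)·|g k − g′ k|` (`c_dir = 1∕4`, `ℓ = 1`, `R = 1`), for all histories. [folklore] -/
theorem dir_couplingLipschitz_wRem (γ : ℝ) (W : Set (ℕ → ℝ)) :
    ∀ g ∈ W, ∀ g' ∈ W, ∀ (k : ℕ) (y : Unit), ∀ a ∈ (wRem γ).S0 k y, ∀ b ∈ (wRem γ).SY k y a, ∀ (j : ℕ),
      ∀ x ∈ (wRem γ).src k y a j, ∀ t ∈ sphere (0:ℂ) ((wRem γ).r k), ∀ (s' : Unit → ℝ) (σ' : Unit → ℂ),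
        OnContour (wRem γ).κ₁ ((wRem γ).cubes k y a b) s' σ' →
          ‖(wRem γ).dir k g y a b x t s' σ' - (wRem γ).dir k g' y a b x t s' σ'‖ ≤
            1 / 2 * (1 / 4 * (fun _ _ : ℕ => (1:ℝ)) k j * (wRem γ).R x.1) * |g k - g' k| := by
  intro g _ g' _ k y a _ b _ j x _ t ht s' σ' _
  show ‖tClamp (1 / 8) t * (gClamp γ (g k) : ℂ) - tClamp (1 / 8) t * (gClamp γ (g' k) : ℂ)‖ ≤
    1 / 2 * (1 / 4 * 1 * 1) * |g k - g' k|
  have ht' : t ∈ sphere (0:ℂ) (1 / 8) := ht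
  rw [← mul_sub, norm_mul, tClamp_of_mem_sphere (by norm_num) ht', ← Complex.ofReal_sub, Complex.norm_real, Real.norm_eq_abs]
  have hn : ‖t‖ = 1 / 8 := by simpa using ht'
  rw [hn]
  have := abs_gClamp_sub_le γ (g k) (g' k)
  nlinarith [abs_nonneg (g k - g' k)]

/-! ## §3 The producers fire on the toy -/

/-- **A3-REM FIRES ON THE TOY (kernel)**: leaf-03-g4's `NE9RemainderSpeciesCoupling.cpieceResponse_rem` APPLIED to `wRem γ` ∕ `wE γ`
on any window `W`, with `ℓ ≡ 1`, `c_dir = 1∕4`, `d₀ = 0`, `N ≡ Nbar = γ`, `cA = 1∕2` — every one of its hypotheses (`Admissible`,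
analyticity, `TermSize`, (d1)–(d3) and the scalars) DISCHARGED by §2: the per-piece coupling response of the toy pieces is bounded as
the producer says.  Non-vacuity of A3-REM's hypothesis set with nonempty index families and coupling-dependent data. [folklore] -/
theorem cpieceResponse_witness {γ : ℝ} (hγ0 : 0 ≤ γ) (hγ1 : γ ≤ 1) (W : Set (ℕ → ℝ)) (κ : ℝ) :
    ∀ g ∈ W, ∀ g' ∈ W, ∀ (k : ℕ) (y : Unit), ∀ a ∈ (wRem γ).toC.S0 k y, ∀ b ∈ (wRem γ).toC.SY k y a, ∀ (j : ℕ),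
      ∀ x ∈ (wRem γ).toC.src k y a j,
      |(wRem γ).toC.piece k g y a b x (wE γ g) - (wRem γ).toC.piece k g' y a b x (wE γ g)| ≤
        KpOf (wRem γ) (1 / 4) k y * (64 * (1 / 2) * γ) * (fun _ _ : ℕ => (1:ℝ)) k j ^ 5 *
          Real.exp (-(κ * (doubleCarriers toyCarriers).d x)) *
          Real.exp (-(1 / 8) * ((wRem γ).κ₁ - 1) * (wRem γ).toC.dY k y + (1 / 8) * (wRem γ).κ₁ * 0 -
            (1 / 2) * ((wRem γ).κ₁ - 1) * (wRem γ).toC.vol k y a b) * |g k - g' k| :=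
  cpieceResponse_rem (admissible_wRem hγ0 hγ1) (Ef := wE γ) (N := fun _ => γ) (Nbar := γ) (clip := 1 / 2)
    (fun g _ => wE_mem_analyticClass γ g) (termSize_wE hγ0 W κ) (fun _ => hγ0) (fun _ => le_rfl) (by norm_num) (by norm_num)
    (fun _ _ => one_pos) (fun _ _ => by norm_num) (dir_contourContinuous_wRem γ) (dir_couplingLipschitz_wRem γ W)

/-- **(w16) FIRES ON THE TOY (kernel)**: leaf-08-g4's `NE9Lemma1RemainderSpeciesAdditive.sBinders_rem` APPLIED — the four channel
structure binders S3 `ChannelAdditive` ∧ S4 `ChannelLocal` ∕ `ChannelStepSum` ∧ S5 `ChannelSizeAtStepNN` hold for the toy channel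
`cpieceChannel (wRem γ).toC` on its analytic class, with the weight `weightOf … 1 0 2 (KpOf (wRem γ) (1∕4))` and profile `tauOfG 1 (agePow ω)`.
Non-vacuity of the S-side binder set (Admissible + counts + the GLOBAL direction pair) on the same datum. [folklore] -/
theorem sBinders_witness {γ : ℝ} (hγ0 : 0 ≤ γ) (hγ1 : γ ≤ 1) (κ : ℝ) {ω : ℝ} (hω : 0 ≤ ω) :
    ChannelAdditive (analyticClass (wRem γ).R) (cpieceChannel (wRem γ).toC) ∧
      ChannelLocal (analyticClass (wRem γ).R) (cpieceChannel (wRem γ).toC) ∧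
      ChannelStepSum (analyticClass (wRem γ).R) (cpieceChannel (wRem γ).toC) ∧
      ChannelSizeAtStepNN (analyticClass (wRem γ).R) (cpieceChannel (wRem γ).toC) κ
        (weightOf (wRem γ).toC.frame (wRem γ).κ₁ 0 2 (KpOf (wRem γ) (1 / 4))) (tauOfG 1 (agePow ω)) :=
  sBinders_rem (admissible_wRem hγ0 hγ1) (fun _ _ => zero_le_one) κ (levelCountsG_wRem γ κ hω) (by norm_num)
    (fun k j => by simpa using agePow_nonneg hω k j) (dir_continuous_wRem γ) (dir_lt_radius_wRem hγ0 hγ1)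

end Summit.QuantumFields.BalabanUV.T4Continuum.NE9RemainderSpeciesWitness

end
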